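import Literature.Analysis.FluidPDE.AxisymmetricTypeIData
import Literature.Analysis.FluidPDE.LerayHopfAssociatedPressure
import HarnessLib

/-!
# The standing hypotheses of the blow-up argument for axisymmetric Leray–Hopf solutions which are
# classical below the final time — without a Type I assumption

Analysis/FluidPDE proofs-layer file on the discharge path of
`Literature.Analysis.FluidPDE.LeiZhang2011_regularity_bmoStream` (Lei–Zhang 2011, Thm. 1.4).
The tree's Type I programme (`AxisymmetricTypeIBounded`, `AxisymmetricTypeIData`, …,
`typeI_boundedNearTop_infinity_holds`, `axisymmetric_typeI_boundedNearTop_offAxis_holds`) proves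
boundedness near the final time **outside a large ball** and **off the axis** under the standing
hypotheses `AxisymmetricTypeIHyp ν T u p`, of which the Type I rate is used for exactly one
datum: `u ∈ L³((0, T) × ℝ³)`. That datum holds for **every** Leray–Hopf solution
(`IsLerayHopfOn.memLp_three_uncurry_slab`, Robinson–Rodrigo–Sadowski 2016, Lemma 3.5). This file
introduces the hypotheses without the Type I field,

* `AxisymmetricL3Hyp ν T u p` — `ν > 0`, `T > 0`, `(u, p)` classical on `[0, T) × ℝ³`,
  Leray–Hopf on `[0, T)` from `u(0)`, bounded on every `[0, T'] × ℝ³` (`T' < T`), axisymmetric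
  slices —

and re-derives the data of `AxisymmetricTypeIData` for it (same statements and proofs, in the
namespace `AxisymmetricL3Hyp`; the `L³` datum from the Leray–Hopf interpolation instead of the
rate). `AxisymmetricTypeIHyp.toL3Hyp` records that the Type I hypotheses are a special case.

## References

* J. C. Robinson, J. L. Rodrigo, W. Sadowski, *The Three-Dimensional Navier–Stokes Equations*,
  CUP 2016, Lemma 3.5. [RobinsonRodrigoSadowski2016]
* L. Caffarelli, R. Kohn, L. Nirenberg, Comm. Pure Appl. Math. 35 (1982), §2 (2.1)–(2.5).
  [CaffarelliKohnNirenberg1982]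
* Z. Lei, Q. S. Zhang, J. Funct. Anal. 261 (2011) = arXiv:1011.5066, Thm. 1.4. [LeiZhang2011]
-/

noncomputable section

open MeasureTheory Set Function Filter Topology TopologicalSpace Metric
open scoped NNReal ENNReal Laplacian

namespace Literature.Analysis.FluidPDE

/-- Local notation for physical space `ℝ³ = EuclideanSpace ℝ (Fin 3)`. -/
local notation "ℝ³" => EuclideanSpace ℝ (Fin 3)

/-- **The standing hypotheses of the blow-up argument at a potential singular time, without a
Type I assumption**: positive viscosity, positive final time, `(u, p)` classical on `[0, T) × ℝ³`,
Leray–Hopf (finite energy) on `[0, T)` from `u(0)`, bounded on every sub-slab `[0, T'] × ℝ³`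
(`T' < T`), axisymmetric slices. (`AxisymmetricTypeIHyp` is this plus `IsTypeIBlowup u T`.)
[cite: LeiZhang2011, Thm. 1.4 (setting of the proof, §4, arXiv p. 12)] -/
structure AxisymmetricL3Hyp (ν T : ℝ) (u : ℝ → ℝ³ → ℝ³) (p : ℝ → ℝ³ → ℝ) : Prop where
  /-- positive viscosity -/
  viscosity_pos : 0 < ν
  /-- positive final time -/
  time_pos : 0 < T
  /-- classical solution on `[0, T)` -/
  classical : IsClassicalNSSolutionOn (Ico 0 T) ν 0 u p
  /-- Leray–Hopf (finite energy) on `[0, T)` -/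
  lerayHopf : IsLerayHopfOn T ν 0 (u 0) u
  /-- bounded on every sub-slab `[0, T'] × ℝ³`, `T' < T` -/
  bounded_subslab : ∀ T' < T, ∃ M : ℝ, ∀ t ∈ Icc 0 T', ∀ x, ‖u t x‖ ≤ M
  /-- axisymmetric slices -/
  axisymmetric : ∀ t ∈ Ico 0 T, IsAxisymmetric (u t)

/-- The Type I standing hypotheses are a special case. [folklore] -/
theorem AxisymmetricTypeIHyp.toL3Hyp {ν T : ℝ} {u : ℝ → ℝ³ → ℝ³} {p : ℝ → ℝ³ → ℝ}
    (H : AxisymmetricTypeIHyp ν T u p) : AxisymmetricL3Hyp ν T u p :=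
  ⟨H.viscosity_pos, H.time_pos, H.classical, H.lerayHopf, H.bounded_subslab, H.axisymmetric⟩

namespace AxisymmetricL3Hyp

variable {ν T : ℝ} {u : ℝ → ℝ³ → ℝ³} {p : ℝ → ℝ³ → ℝ}

/-! ### The classical solution on the open interval -/

/-- The classical solution restricted to the open time interval `(0, T)`. [folklore] -/
theorem classical_Ioo (H : AxisymmetricL3Hyp ν T u p) :
    IsClassicalNSSolutionOn (Ioo 0 T) ν 0 u p :=
  H.classical.mono Ioo_subset_Ico_self isOpen_Ioo.uniqueDiffOn

/-- On the open interval the one-sided time derivative within `(0, T)` is the two-sided one.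
[folklore] -/
theorem timeDerivWithin_Ioo_eq {t : ℝ} (ht : t ∈ Ioo 0 T) (x : ℝ³) :
    timeDerivWithin (Ioo 0 T) u t x = timeDeriv u t x := by
  simp only [timeDerivWithin, timeDeriv]
  exact derivWithin_of_isOpen isOpen_Ioo ht

/-- **The momentum equation with the two-sided time derivative** on `(0, T) × ℝ³`. [folklore] -/
theorem momentum_timeDeriv (H : AxisymmetricL3Hyp ν T u p) {t : ℝ} (ht : t ∈ Ioo 0 T)
    (x : ℝ³) :
    timeDeriv u t x + convect (u t) (u t) x = ν • (Δ (u t)) x - gradient (p t) x + (0 : ℝ → ℝ³ → ℝ³) t x := by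
  rw [← timeDerivWithin_Ioo_eq ht x]
  exact H.classical_Ioo.momentum t ht x

/-- **`(u, p)` is a suitable weak solution on every open region below the final time**
(accepted local notion `IsSuitableWeakSolutionOn`; CKN 1982 (2.1)–(2.5) with equality in (2.5)
for smooth solutions, by `isSuitableWeakSolutionOn_of_contDiffOn`). [cite: CaffarelliKohnNirenberg1982, §2 (2.1)–(2.5)] -/
theorem isSuitableWeakSolutionOn (H : AxisymmetricL3Hyp ν T u p) (Q : Opens (ℝ × ℝ³))
    (hQ : (Q : Set (ℝ × ℝ³)) ⊆ Ioo 0 T ×ˢ univ) : IsSuitableWeakSolutionOn Q ν 0 u p := by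
  have hcl := H.classical_Ioo
  refine isSuitableWeakSolutionOn_of_contDiffOn isOpen_Ioo hQ
    (hcl.smooth_velocity.of_le (by norm_cast)) (hcl.smooth_pressure.of_le (by norm_cast)) ?_
    (fun t ht x => H.momentum_timeDeriv ht x) hcl.divFree
  exact continuousOn_const

/-- The distributional system on every open region below the final time (projection).
[cite: CaffarelliKohnNirenberg1982, §2 (2.2)] -/
theorem isDistributionalNSSolutionOn (H : AxisymmetricL3Hyp ν T u p) (Q : Opens (ℝ × ℝ³))
    (hQ : (Q : Set (ℝ × ℝ³)) ⊆ Ioo 0 T ×ˢ univ) : IsDistributionalNSSolutionOn Q ν 0 u p :=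
  (H.isSuitableWeakSolutionOn Q hQ).distributional

/-! ### Energy and the Type I rate -/

/-- **The energy bound**: `∫ |u(t)|² ≤ 2 E(u(0))` for `0 ≤ t < T` (energy inequality of the
Leray–Hopf solution from `s = 0`). [folklore] -/
theorem eEnergy_le (H : AxisymmetricL3Hyp ν T u p) {t : ℝ} (ht : t ∈ Ico 0 T) :
    eEnergy (u t) ≤ ENNReal.ofReal (2 * VectorCalculus.kineticEnergy (u 0)) := by
  obtain ⟨G, -, -, hE, -⟩ := H.lerayHopf.weakGrad_energy
  have hE' : ∀ t ∈ Icc 0 T, VectorCalculus.kineticEnergy (u t) +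
      ν * (∫⁻ τ in Ioo 0 t, ∫⁻ x, ENNReal.ofReal (frobeniusNormSq (G τ x))).toReal ≤
        VectorCalculus.kineticEnergy (u 0) := fun t ht => by simpa using hE t ht
  have ht' : t ∈ Icc 0 T := ⟨ht.1, ht.2.le⟩
  rw [eEnergy_eq_ofReal _ (H.lerayHopf.memLp t ht')]
  exact ENNReal.ofReal_le_ofReal
    (by linarith [kineticEnergy_le_of_energy_ineq H.viscosity_pos.le hE' ht'])

/-- **`u ∈ L³((0, T) × ℝ³)`** under the standing hypotheses — for every Leray–Hopf solution
(`IsLerayHopfOn.memLp_three_uncurry_slab`, Robinson–Rodrigo–Sadowski 2016, Lemma 3.5), by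
Tonelli. [cite: RobinsonRodrigoSadowski2016, Lemma 3.5] -/
theorem lintegral_Ioo_lintegral_enorm_pow_three_lt_top (H : AxisymmetricL3Hyp ν T u p) :
    ∫⁻ t in Ioo 0 T, ∫⁻ x, ‖u t x‖ₑ ^ (3 : ℕ) < ∞ := by
  have hmem := H.lerayHopf.memLp_three_uncurry_slab
  have hlt := hmem.2
  rw [eLpNorm_lt_top_iff_lintegral_rpow_enorm_lt_top (by norm_num) (by norm_num)] at hlt
  rw [ENNReal.toReal_ofNat, volume_restrict_slab_eq_prod₃] at hlt
  have hm : AEStronglyMeasurable (uncurry u)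
      ((volume.restrict (Ioo 0 T)).prod (volume : Measure ℝ³)) := by
    rw [← volume_restrict_slab_eq_prod₃]; exact hmem.1
  rw [lintegral_prod _ (hm.enorm.pow_const _)] at hlt
  calc ∫⁻ t in Ioo 0 T, ∫⁻ x, ‖u t x‖ₑ ^ (3 : ℕ)
      = ∫⁻ t in Ioo 0 T, ∫⁻ x, ‖uncurry u (t, x)‖ₑ ^ (3 : ℝ) := by
        refine lintegral_congr fun t => lintegral_congr fun x => ?_
        rw [← ENNReal.rpow_natCast]; rfl
    _ < ∞ := hlt

end AxisymmetricL3Hyp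

end Literature.Analysis.FluidPDE

end
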